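import Summits.BirchSwinnertonDyer.BirchSwinnertonDyer.Theorems.ByReductionTypeAtTwoMultUpperHalfKatoIntSplit
import Summits.BirchSwinnertonDyer.BirchSwinnertonDyer.Theorems.ByReductionTypeAtTwoMultUpperHalfKatoIntSplitDefs
import Summits.BirchSwinnertonDyer.BirchSwinnertonDyer.Theorems.ByReductionTypeAtTwoMultUpperHalfCloses
import HarnessLib

/-!
# Route `ByReductionTypeAtTwo`, crux `MultUpperHalfAtTwo` (item stmt-BirchSwinnertonDyer-19922): GLUE — the crux from
# its SIX-road leaves (PUB ∧8 → MEMO ×5 leaves → RESIDUAL leaf), one application of `multUpperHalfAtTwo_of_sixRoads'`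

HONEST FRAMING (cell `bsd-2adic`, seat `bsd-2adic-mult-2` GEN 3): THEOREMS ONLY; nothing asserted beyond the leaves'
own displayed status (MEMO / RESIDUAL, `@[conjecture]`, nothing booked); BSD is not proved by any of this. PARTITION:
X5@2 mult (K4ᵐ, B1·O1; 1 976 classes) × p = 2 — types-the-object-of; closes none.

The line `four_roads` of the crux (Cruxes/MultUpperHalfAtTwo/Lines/four_roads.lean) reshaped to SEVEN stubs reads its
composition off this theorem: `stub_pub` (PUB ∧8, guarded Thm-4.1 analogue) · `stub_gsSplit` · `stub_katoRat` ·
`stub_katoIntNsSurj` · `stub_katoUpToOne` · `stub_katoIntSpSurj` (:= `KatoIntAtSplitSurjectiveTwo ∧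
KatoUpToOneAtSplitSurjectiveTwo`, ONE memo PROOF-KATO2SPLIT) · `stub_offSixRoads` (the WALL, 194 r0 classes).
Census (r0): six roads 1 775 / 1 969; residual 194 = 52 small `2`-adic image + 142 «neither».
-/

set_option autoImplicit false
set_option linter.dupNamespace false

noncomputable section

open scoped Classical MatrixGroups ModularForm

open CongruenceSubgroup WeierstrassCurve Literature.NumberTheory.EllipticCurves
  Literature.NumberTheory.EllipticCurves.ModularForms
  Literature.NumberTheory.EllipticCurves.Greenberg1999
  Literature.NumberTheory.EllipticCurves.Rank1Residual
  Literature.NumberTheory.EllipticCurves.Rank1Residual.Typed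
  Summit.BirchSwinnertonDyer.Rank1Residual.X5

namespace Summit.BirchSwinnertonDyer.BirchSwinnertonDyer.Theorems

/-- **GLUE (six roads, guarded PUB): item 19922 from its leaves** — PRINT ×8 (the GUARDED Thm-4.1 analogue
`…_anyPrime_oddLocalDegree`, A236, modularity, GZK, Cassels, Prop. 5.14 at `2`, Česnavičius, Cassels–Tate) → MEMO
leaves {`GreenbergStevensAtSplitTwo`, `KatoRatAtMultTwo`, `KatoIntAtNonsplitSurjectiveTwo`,
`KatoUpToOneAtNonsplitSurjectiveTwo`, `KatoIntAtSplitSurjectiveTwo`, `KatoUpToOneAtSplitSurjectiveTwo`} → RESIDUAL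
leaf `UpperHalfOffSixRoadsAtMultTwo` → `MultUpperHalfAtTwo`; the leaves unfold to the binders of
`multUpperHalfAtTwo_of_sixRoads'` by `rfl`. [cite: GreenbergLNM1716, §4 pp. 112–113 and Prop. 5.14 (p. 121)]
[cite: Kato2004Asterisque, Thm. 17.4 and 17.11–17.13 (shape)] [cite: Miller2011LMS, Def. 1.1] -/
theorem multUpperHalfAtTwo_of_leaves_sixRoads'
    (h41ns' : thm41Analogue_charValue_rankZero_numberField_anyPrime_oddLocalDegree)
    (h41sp : thm41Analogue_charValue_rankZero_split_baseChange_anyPrime)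
    (hmod : nonempty_modularParametrizationData)
    (hGZK : rank_eq_analyticRank_of_analyticRank_le_one)
    (hCassels : bsdRHS_eq_of_isIsogenous)
    (h514 : prop514_isTorsion_mu_eq_zero_two)
    (hC : cesnavicius_not_two_dvd_maninConstant_of_two_dvd_level)
    (hCT : WeierstrassCurve.exists_casselsTate_pairing (K := ℚ))
    (hGS : MultUpperHalvesAtTwo.GreenbergStevensAtSplitTwo) (hKato : MultUpperHalvesAtTwo.KatoRatAtMultTwo)
    (hKint : MultUpperHalvesAtTwo.KatoIntAtNonsplitSurjectiveTwo)
    (hK1 : MultUpperHalvesAtTwo.KatoUpToOneAtNonsplitSurjectiveTwo)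
    (hKintSp : MultUpperHalvesAtTwo.KatoIntAtSplitSurjectiveTwo)
    (hK1sp : MultUpperHalvesAtTwo.KatoUpToOneAtSplitSurjectiveTwo)
    (hoff : MultUpperHalvesAtTwo.UpperHalfOffSixRoadsAtMultTwo) :
    Summit.BirchSwinnertonDyer.BirchSwinnertonDyer.Theses.ByReductionTypeAtTwo.MultUpperHalfAtTwo :=
  multUpperHalfAtTwo_of_sixRoads' hKato h41ns' h41sp hmod hGZK hCassels h514 hC hCT hGS hKint hK1 hKintSp hK1sp hoff

/-- **The same with the two split MEMO leaves bundled** (one memo PROOF-KATO2SPLIT ⇒ one stub `stub_katoIntSpSurj` of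
the reshaped line). [cite: Kato2004Asterisque, Lemma 17.12 proof (p. 278) (shape)] [cite: Miller2011LMS, Def. 1.1] -/
theorem multUpperHalfAtTwo_of_leaves_sixRoads_bundled'
    (hpub : thm41Analogue_charValue_rankZero_numberField_anyPrime_oddLocalDegree ∧
      thm41Analogue_charValue_rankZero_split_baseChange_anyPrime ∧
      nonempty_modularParametrizationData ∧ rank_eq_analyticRank_of_analyticRank_le_one ∧
      bsdRHS_eq_of_isIsogenous ∧ prop514_isTorsion_mu_eq_zero_two ∧
      cesnavicius_not_two_dvd_maninConstant_of_two_dvd_level ∧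
      WeierstrassCurve.exists_casselsTate_pairing (K := ℚ))
    (hGS : MultUpperHalvesAtTwo.GreenbergStevensAtSplitTwo) (hKato : MultUpperHalvesAtTwo.KatoRatAtMultTwo)
    (hKint : MultUpperHalvesAtTwo.KatoIntAtNonsplitSurjectiveTwo)
    (hK1 : MultUpperHalvesAtTwo.KatoUpToOneAtNonsplitSurjectiveTwo)
    (hKsp : MultUpperHalvesAtTwo.KatoIntAtSplitSurjectiveTwo ∧ MultUpperHalvesAtTwo.KatoUpToOneAtSplitSurjectiveTwo)
    (hoff : MultUpperHalvesAtTwo.UpperHalfOffSixRoadsAtMultTwo) :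
    Summit.BirchSwinnertonDyer.BirchSwinnertonDyer.Theses.ByReductionTypeAtTwo.MultUpperHalfAtTwo := by
  obtain ⟨h41ns', h41sp, hmod, hGZK, hCassels, h514, hC, hCT⟩ := hpub
  exact multUpperHalfAtTwo_of_leaves_sixRoads' h41ns' h41sp hmod hGZK hCassels h514 hC hCT hGS hKato hKint hK1 hKsp.1
    hKsp.2 hoff

end Summit.BirchSwinnertonDyer.BirchSwinnertonDyer.Theorems

end
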